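import Literature.NumberTheory.EllipticCurves.GreenbergVatsal2000.NonPrimitiveDatumSelmerInvariants
import HarnessLib

/-!
# K1 — transport of the classical Pontryagin-dual data to GV's datum Selmer groups (shape (β))
# (cell `b2b-bsdres`, team n1011, seat p06 GEN 5; OWNERS row T-A240-PORT, item K1; consumer: seat
# p12's K4 = A240 `muLambdaAlg_transfer_of_torsionIso_potOrd_of_not_dvd_torsionOrder` as a theorem)

HONEST FRAMING (cell `b2b-bsdres`, run/shared/lean/b2b/bsd-rank1-residual/, verbatim in every
file): the goal of the cell is to DELETE the COMBINATION-SHAPED residual classes of the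
Birch–Swinnerton-Dyer formula for ALL analytic-rank `≤ 1` elliptic curves over `ℚ` — "full BSD
formula for every rank `≤ 1` curve in class `C`" assembled STRICTLY from published theorems — so
that the rank-`≤ 1` remainder becomes exactly the CONSTRUCTION-SHAPED classes, which are TYPED
(missing-input `Prop`s), NOT attempted. This is not "finishing BSD". Team n1011: research routes on
CONSTRUCTION-SHAPED classes (ARM α / A240 discharge); census output = EVIDENCE, never a Literature
fact; RESIDUAL-MAP marks UNCHANGED; nothing is booked by this file. THEOREMS ONLY: no definition,
no named fact (the dual data are CONSTRUCTED inside the proofs; the tree's record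
`GreenbergVatsal2000.datumSelmer_nonPrimitive_invariants` (T-GV23L, p285310) is NOT used here).

## What and why

The tree's named record of GV 2000 §2 (Cor. (2.3) + Prop. (2.4) at the datum,
`Literature/…/GreenbergVatsal2000/NonPrimitiveDatumSelmerInvariants`) speaks of Pontryagin-dual data
`DatumDualData κ γ A L S₀` for the DATUM Selmer groups `S^{S₀}_A(K_∞) = datumSelmerInfty κ A L S₀`,
while the classical Iwasawa modules of the cell are dual data for the CLASSICAL groups:
`WeierstrassCurve.SelmerDualData W κ γ` (dual of `Sel_E(K_∞)_p = W.selmerInfty κ`) and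
`GreenbergVatsal2000.NonPrimitiveDualData W κ γ S₀` (dual of `Sel^{Σ₀}_E(K_∞)_p =
nonPrimitiveSelmerInfty W κ S₀`).  Whenever the subgroups are EQUAL —
`Additive.selmerInfty_eq_datumSelmerInfty` / `Additive.nonPrimitiveSelmerInfty_eq_datumSelmerInfty`
(p288232: `p` odd, `κ` cyclotomic, the R-D identity at `p`, ANY reduction elsewhere) — a classical
dual datum IS a datum dual datum on the same `Λ`-module: the dual map is precomposed with the
inclusion of the two equal subgroups, and the `T = γ − 1` and `ℤ_p`-compatibilities are
carried verbatim (`conjH1` is the same map on both; its stability on the datum group is lit's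
PROVED `conjH1_mem_datumSelmer`).  Shape (β) (p12 GEN 6 16:10Z, lead GEN 7 R5-67 (o)): an
EXISTENCE statement with a `Λ`-linear equivalence `D'.X ≃ₗ[Λ] D.X` (here the identity), along
which `Module.Finite`, `Module.IsTorsion`, `μ`, `λ` and "no finite submodule" move by the tree's
invariance lemmas.

* `exists_datumDualData_linearEquiv_of_selmerDualData` — primitive:
  `SelmerDualData ↦ DatumDualData … L ∅`;
* `exists_datumDualData_linearEquiv_of_nonPrimitiveDualData` — non-primitive:
  `NonPrimitiveDualData … S₀ ↦ DatumDualData … L S₀`.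

References: Greenberg–Vatsal 2000 §2 pp. 17, 20–21 [GreenbergVatsal2000]; Greenberg LNM 1716 §2
[GreenbergLNM1716].
-/

set_option autoImplicit false

noncomputable section

open scoped Classical

universe u

namespace Summit.BirchSwinnertonDyer.Rank1Residual.Additive

open NumberField IsDedekindDomain Field WeierstrassCurve
  Literature.NumberTheory.EllipticCurves Literature.NumberTheory.EllipticCurves.GreenbergSelmer
  Literature.NumberTheory.EllipticCurves.GreenbergVatsal2000

/-- Pure algebra: the inclusions along an equality `A = B` of subgroups compose to the identity
(stated propositionally — the kernel must never compare the two membership predicates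
definitionally). [folklore] -/
theorem inclusion_inclusion_of_eq {G : Type*} [AddGroup G] {A B : AddSubgroup G} (h : A = B)
    (s : B) : AddSubgroup.inclusion h.le (AddSubgroup.inclusion h.ge s) = s :=
  Subtype.ext (by rw [AddSubgroup.coe_inclusion, AddSubgroup.coe_inclusion])

/-- Pure algebra, the other composite. [folklore] -/
theorem inclusion_inclusion_of_eq' {G : Type*} [AddGroup G] {A B : AddSubgroup G} (h : A = B)
    (s : A) : AddSubgroup.inclusion h.ge (AddSubgroup.inclusion h.le s) = s :=
  Subtype.ext (by rw [AddSubgroup.coe_inclusion, AddSubgroup.coe_inclusion])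

section Transport

variable {K : Type u} [Field K] [NumberField K] (W : WeierstrassCurve K) {p : ℕ} [Fact p.Prime]
  (κ : ZpExtension K p) (γ : absoluteGaloisGroup K) (L : Data K (W.geomPrimaryTorsion p) p)
  (S₀ : Set (HeightOneSpectrum (𝓞 K)))

/-- **K1, primitive transport (shape (β)).** A Pontryagin-dual datum `D` for the classical
`Sel_E(K_∞)_p` (`WeierstrassCurve.SelmerDualData`) and the subgroup equality
`Sel_E(K_∞)_p = S_{E[p^∞]}(K_∞)` (`h`; `Additive.selmerInfty_eq_datumSelmerInfty` under `p` odd,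
`κ` cyclotomic and the R-D identity at `p`) give a dual datum `D'` for the datum Selmer group
(`GreenbergVatsal2000.DatumDualData … L ∅`) on the SAME `Λ`-module: `D'.X ≃ₗ[Λ] D.X` (indeed `=`).
The dual map is `D.toDual` precomposed with the inclusion `S_{E[p^∞]}(K_∞) ↪ Sel_E(K_∞)_p` along
`h`; the `T`- and `ℤ_p`-compatibilities are carried verbatim.
[cite: GreenbergVatsal2000, §2 pp. 17, 20–21] -/
theorem exists_datumDualData_linearEquiv_of_selmerDualData (D : W.SelmerDualData κ γ)
    (h : W.selmerInfty κ = datumSelmerInfty κ (W.geomPrimaryTorsion p) L ∅) :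
    ∃ D' : DatumDualData κ γ (W.geomPrimaryTorsion p) L ∅,
      Nonempty (D'.X ≃ₗ[IwasawaAlgebra p] D.X) := by
  let ι : datumSelmerInfty κ (W.geomPrimaryTorsion p) L ∅ →+ W.selmerInfty κ :=
    AddSubgroup.inclusion h.ge
  let ι' : W.selmerInfty κ →+ datumSelmerInfty κ (W.geomPrimaryTorsion p) L ∅ :=
    AddSubgroup.inclusion h.le
  have hιι' : ∀ s, ι (ι' s) = s := inclusion_inclusion_of_eq' h
  have hι'ι : ∀ s, ι' (ι s) = s := inclusion_inclusion_of_eq h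
  let t : D.X →+ (datumSelmerInfty κ (W.geomPrimaryTorsion p) L ∅ →+ AddCircle (1 : ℚ)) :=
    { toFun := fun x ↦ (D.toDual x).comp ι
      map_zero' := by rw [map_zero, AddMonoidHom.zero_comp]
      map_add' := fun x y ↦ by rw [map_add, AddMonoidHom.add_comp] }
  have ht : ∀ x s, t x s = D.toDual x (ι s) := fun _ _ ↦ rfl
  have hinj : Function.Injective t := fun x y hxy ↦ D.bijective.1 (by
    ext s
    have h1 := DFunLike.congr_fun hxy (ι' s)
    rwa [ht, ht, hιι'] at h1)
  have hsurj : Function.Surjective t := fun g ↦ by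
    obtain ⟨x, hx⟩ := D.bijective.2 (g.comp ι')
    refine ⟨x, ?_⟩
    ext s
    rw [ht, hx, AddMonoidHom.comp_apply, hι'ι]
  have hT : ∀ (x : D.X) (s : datumSelmerInfty κ (W.geomPrimaryTorsion p) L ∅),
      t ((PowerSeries.X : IwasawaAlgebra p) • x) s =
        t x ⟨conjH1 κ.kerSubgroup (W.geomPrimaryTorsion p) γ s,
          conjH1_mem_datumSelmer κ.kerSubgroup (W.geomPrimaryTorsion p) p L ∅ γ s.2⟩ - t x s :=
    fun x s ↦ by
    rw [ht, ht, ht, D.toDual_T_smul]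
    refine congrArg (fun u ↦ D.toDual x u - D.toDual x (ι s)) (Subtype.ext ?_)
    simp only [ι, AddSubgroup.coe_inclusion]
  have hC : ∀ (c : ℤ_[p]) (x : D.X) (s : datumSelmerInfty κ (W.geomPrimaryTorsion p) L ∅) (k : ℕ),
      (p ^ k) • s = 0 → t (PowerSeries.C c • x) s = (PadicInt.toZModPow k c).val • t x s :=
    fun c x s k hk ↦ by
    have hk' : (p ^ k) • (ι s) = 0 := by rw [← map_nsmul, hk, map_zero]
    rw [ht, ht, D.toDual_C_smul c x (ι s) k hk']
  let D' : DatumDualData κ γ (W.geomPrimaryTorsion p) L ∅ :=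
    { X := D.X, toDual := t, bijective := ⟨hinj, hsurj⟩, toDual_T_smul := hT, toDual_C_smul := hC }
  exact ⟨D', ⟨LinearEquiv.refl (IwasawaAlgebra p) D.X⟩⟩

/-- **K1, non-primitive transport (shape (β)).** A dual datum `DS` for GV's classical
`Sel^{Σ₀}_E(K_∞)_p` (`GreenbergVatsal2000.NonPrimitiveDualData`) and the subgroup equality
`Sel^{Σ₀}_E(K_∞)_p = S^{Σ₀}_{E[p^∞]}(K_∞)` (`h`;
`Additive.nonPrimitiveSelmerInfty_eq_datumSelmerInfty`) give a dual datum `D'` for `S^{Σ₀}`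
(`DatumDualData … L S₀`) with `D'.X ≃ₗ[Λ] DS.X`. [cite: GreenbergVatsal2000, §2 pp. 17, 20–21] -/
theorem exists_datumDualData_linearEquiv_of_nonPrimitiveDualData
    (DS : NonPrimitiveDualData W κ γ S₀)
    (h : nonPrimitiveSelmerInfty W κ S₀ = datumSelmerInfty κ (W.geomPrimaryTorsion p) L S₀) :
    ∃ D' : DatumDualData κ γ (W.geomPrimaryTorsion p) L S₀,
      Nonempty (D'.X ≃ₗ[IwasawaAlgebra p] DS.X) := by
  let ι : datumSelmerInfty κ (W.geomPrimaryTorsion p) L S₀ →+ nonPrimitiveSelmerInfty W κ S₀ :=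
    AddSubgroup.inclusion h.ge
  let ι' : nonPrimitiveSelmerInfty W κ S₀ →+ datumSelmerInfty κ (W.geomPrimaryTorsion p) L S₀ :=
    AddSubgroup.inclusion h.le
  have hιι' : ∀ s, ι (ι' s) = s := inclusion_inclusion_of_eq' h
  have hι'ι : ∀ s, ι' (ι s) = s := inclusion_inclusion_of_eq h
  let t : DS.X →+ (datumSelmerInfty κ (W.geomPrimaryTorsion p) L S₀ →+ AddCircle (1 : ℚ)) :=
    { toFun := fun x ↦ (DS.toDual x).comp ι
      map_zero' := by rw [map_zero, AddMonoidHom.zero_comp]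
      map_add' := fun x y ↦ by rw [map_add, AddMonoidHom.add_comp] }
  have ht : ∀ x s, t x s = DS.toDual x (ι s) := fun _ _ ↦ rfl
  have hinj : Function.Injective t := fun x y hxy ↦ DS.bijective.1 (by
    ext s
    have h1 := DFunLike.congr_fun hxy (ι' s)
    rwa [ht, ht, hιι'] at h1)
  have hsurj : Function.Surjective t := fun g ↦ by
    obtain ⟨x, hx⟩ := DS.bijective.2 (g.comp ι')
    refine ⟨x, ?_⟩
    ext s
    rw [ht, hx, AddMonoidHom.comp_apply, hι'ι]
  have hT : ∀ (x : DS.X) (s : datumSelmerInfty κ (W.geomPrimaryTorsion p) L S₀),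
      t ((PowerSeries.X : IwasawaAlgebra p) • x) s =
        t x ⟨conjH1 κ.kerSubgroup (W.geomPrimaryTorsion p) γ s,
          conjH1_mem_datumSelmer κ.kerSubgroup (W.geomPrimaryTorsion p) p L S₀ γ s.2⟩ - t x s :=
    fun x s ↦ by
    rw [ht, ht, ht, DS.toDual_T_smul]
    refine congrArg (fun u ↦ DS.toDual x u - DS.toDual x (ι s)) (Subtype.ext ?_)
    simp only [ι, AddSubgroup.coe_inclusion]
  have hC : ∀ (c : ℤ_[p]) (x : DS.X) (s : datumSelmerInfty κ (W.geomPrimaryTorsion p) L S₀)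
      (k : ℕ), (p ^ k) • s = 0 →
      t (PowerSeries.C c • x) s = (PadicInt.toZModPow k c).val • t x s :=
    fun c x s k hk ↦ by
    have hk' : (p ^ k) • (ι s) = 0 := by rw [← map_nsmul, hk, map_zero]
    rw [ht, ht, DS.toDual_C_smul c x (ι s) k hk']
  let D' : DatumDualData κ γ (W.geomPrimaryTorsion p) L S₀ :=
    { X := DS.X, toDual := t, bijective := ⟨hinj, hsurj⟩, toDual_T_smul := hT, toDual_C_smul := hC }
  exact ⟨D', ⟨LinearEquiv.refl (IwasawaAlgebra p) DS.X⟩⟩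

end Transport

end Summit.BirchSwinnertonDyer.Rank1Residual.Additive

end
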